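import Mathlib
import Literature.NumberTheory.Transcendental.SemialgebraicLineDeriv
import Summits.KontsevichZagierPeriods.KontsevichZagierPeriods.Theorems.IsogenyCertificatesJLPairCalculus
import HarnessLib

/-!
# The Jacquet–Langlands correspondence for `X_0^{35}`: semialgebraicity of the branch data

Support file for `JLPairIdentityX` (stmt-KontsevichZagierPeriods-14655): all branch data are
`ℚ`-semialgebraic functions of `p : Fin 1 → ℝ` through `p 0` (closure of semialgebraic functions
under `+, −, ·, ⁻¹, √`, Bochnak–Coste–Roy Prop. 2.2.6, as discharged in the tree), and, given the
semialgebraic half-line `{p 0 < −1}`, the pieces `{p 0 < u_m}`, `{u_m < p 0 < −1}`, `{p 0 = u_m}` are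
`ℚ`-semialgebraic sets (the irrational `u_m` being described by the sign of the polynomial `R_c`).
-/

namespace Summit.KontsevichZagierPeriods.IsogenyCertificates.JLPair

open Literature.Algebra.Polynomial

/-! ### Semialgebraicity of the branch data (as functions of `p : Fin 1 → ℝ` through `p 0`) -/

section Semialgebraic

open Set
open Literature.NumberTheory.Transcendental Literature.ModelTheory.ExponentialFields

variable {W : Set (Fin 1 → ℝ)}

/-- Quotients of real `ℚ`-semialgebraic functions are semialgebraic (Mathlib's `x / 0 = 0`).
[cite: BochnakCosteRoy1998, Prop. 2.2.6] -/
theorem semialg_div {f g : (Fin 1 → ℝ) → ℝ} (hf : IsSemialgebraicFunOn ℚ W f) (hg : IsSemialgebraicFunOn ℚ W g) :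
    IsSemialgebraicFunOn ℚ W fun x => f x / g x :=
  (hf.fun_mul hg.fun_inv).congr fun x _ => by simp [div_eq_mul_inv]

/-- The coordinate `p ↦ p 0` is `ℚ`-semialgebraic. [cite: BochnakCosteRoy1998, §2.2] -/
theorem semialg_coord (hW : IsSemialgebraic ℚ W) : IsSemialgebraicFunOn ℚ W fun p : Fin 1 → ℝ => p 0 :=
  (isSemialgebraicFunOn_aeval hW (MvPolynomial.X 0 : MvPolynomial (Fin 1) ℚ)).congr fun p _ => by simp

/-- Evaluation of an integer coefficient list at `p 0` is `ℚ`-semialgebraic. [cite: BochnakCosteRoy1998, §2.2] -/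
theorem semialg_eval (hW : IsSemialgebraic ℚ W) :
    ∀ l : List ℤ, IsSemialgebraicFunOn ℚ W fun p : Fin 1 → ℝ => CoeffList.eval (p 0) l
  | [] => (isSemialgebraicFunOn_const_intCast hW 0).congr fun p _ => by simp
  | a :: l => ((isSemialgebraicFunOn_const_intCast hW a).fun_add
      ((semialg_coord hW).fun_mul (semialg_eval hW l))).congr fun p _ => by
        simp [CoeffList.eval_cons]

/-- `p ↦ f_C (p 0)` is `ℚ`-semialgebraic. [cite: BochnakCosteRoy1998, §2.2] -/
theorem semialg_fC (hW : IsSemialgebraic ℚ W) : IsSemialgebraicFunOn ℚ W fun p : Fin 1 → ℝ => fC (p 0) :=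
  (semialg_eval hW cFC).congr fun p _ => by
    simp [fC, cFC, CoeffList.eval_cons]; ring

/-- `p ↦ f_X (p 0)` is `ℚ`-semialgebraic. [cite: BochnakCosteRoy1998, §2.2] -/
theorem semialg_fX (hW : IsSemialgebraic ℚ W) : IsSemialgebraicFunOn ℚ W fun p : Fin 1 → ℝ => fX (p 0) :=
  (semialg_eval hW [0, -28, -415, -2456, -7248, -10636, -6192]).congr fun p _ => by
    simp [fX, CoeffList.eval_cons]; ring

/-- `p ↦ √disc (p 0)` is `ℚ`-semialgebraic. [cite: BochnakCosteRoy1998, Prop. 2.2.6] -/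
theorem semialg_sD (hW : IsSemialgebraic ℚ W) : IsSemialgebraicFunOn ℚ W fun p : Fin 1 → ℝ => sD (p 0) :=
  (semialg_eval hW cD).fun_sqrt

/-- `p ↦ x_b (p 0)` is `ℚ`-semialgebraic. [cite: BochnakCosteRoy1998, Prop. 2.2.6] -/
theorem semialg_xb (hW : IsSemialgebraic ℚ W) : IsSemialgebraicFunOn ℚ W fun p : Fin 1 → ℝ => xb (p 0) :=
  semialg_div ((semialg_eval hW cP1).fun_add (semialg_sD hW))
    ((isSemialgebraicFunOn_const_ofNat hW 2).fun_mul (semialg_eval hW cQ))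

/-- `p ↦ x_t (p 0)` is `ℚ`-semialgebraic. [cite: BochnakCosteRoy1998, Prop. 2.2.6] -/
theorem semialg_xt (hW : IsSemialgebraic ℚ W) : IsSemialgebraicFunOn ℚ W fun p : Fin 1 → ℝ => xt (p 0) :=
  semialg_div ((semialg_eval hW cP1).fun_sub (semialg_sD hW))
    ((isSemialgebraicFunOn_const_ofNat hW 2).fun_mul (semialg_eval hW cQ))

/-- `p ↦ x_b' (p 0)` is `ℚ`-semialgebraic. [cite: BochnakCosteRoy1998, Prop. 2.2.6] -/
theorem semialg_dxb (hW : IsSemialgebraic ℚ W) : IsSemialgebraicFunOn ℚ W fun p : Fin 1 → ℝ => dxb (p 0) :=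
  semialg_div (((semialg_xb hW).fun_mul (semialg_eval hW cD1)).fun_sub (semialg_eval hW cD2))
    ((semialg_eval hW cQ).fun_mul (semialg_sD hW))

/-- `p ↦ x_t' (p 0)` is `ℚ`-semialgebraic. [cite: BochnakCosteRoy1998, Prop. 2.2.6] -/
theorem semialg_dxt (hW : IsSemialgebraic ℚ W) : IsSemialgebraicFunOn ℚ W fun p : Fin 1 → ℝ => dxt (p 0) :=
  semialg_div (((semialg_xt hW).fun_mul (semialg_eval hW cD1)).fun_sub (semialg_eval hW cD2))
    ((semialg_eval hW cQ).fun_mul (semialg_sD hW)).fun_neg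

/-- `p ↦ M_b (p 0)` is `ℚ`-semialgebraic. [cite: BochnakCosteRoy1998, Prop. 2.2.6] -/
theorem semialg_Mb (hW : IsSemialgebraic ℚ W) : IsSemialgebraicFunOn ℚ W fun p : Fin 1 → ℝ => Mb (p 0) :=
  ((semialg_eval hW cN1).fun_mul (semialg_xb hW)).fun_add (semialg_eval hW cN0)

/-- `p ↦ M_t (p 0)` is `ℚ`-semialgebraic. [cite: BochnakCosteRoy1998, Prop. 2.2.6] -/
theorem semialg_Mt (hW : IsSemialgebraic ℚ W) : IsSemialgebraicFunOn ℚ W fun p : Fin 1 → ℝ => Mt (p 0) :=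
  ((semialg_eval hW cN1).fun_mul (semialg_xt hW)).fun_add (semialg_eval hW cN0)

/-- `p ↦ g_b (p 0)` is `ℚ`-semialgebraic. [cite: BochnakCosteRoy1998, Prop. 2.2.6] -/
theorem semialg_gb (hW : IsSemialgebraic ℚ W) : IsSemialgebraicFunOn ℚ W fun p : Fin 1 → ℝ => gb (p 0) :=
  semialg_div (((semialg_xb hW).fun_mul (semialg_dxb hW)).fun_mul (semialg_eval hW cE))
    ((semialg_Mb hW).fun_mul (semialg_fC hW).fun_sqrt)

/-- `p ↦ g_t (p 0)` is `ℚ`-semialgebraic. [cite: BochnakCosteRoy1998, Prop. 2.2.6] -/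
theorem semialg_gt (hW : IsSemialgebraic ℚ W) : IsSemialgebraicFunOn ℚ W fun p : Fin 1 → ℝ => gt (p 0) :=
  semialg_div (((semialg_xt hW).fun_mul (semialg_dxt hW)).fun_mul (semialg_eval hW cE))
    ((semialg_Mt hW).fun_mul (semialg_fC hW).fun_sqrt)

/-- The left piece `{p | p 0 < −1 ∧ R_c(p 0) < 0} = {p | p 0 < u_m}` is `ℚ`-semialgebraic.
[cite: BochnakCosteRoy1998, §2.2] -/
theorem isSemialgebraic_left (hI : IsSemialgebraic ℚ {p : Fin 1 → ℝ | p 0 < -1}) :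
    IsSemialgebraic ℚ {p : Fin 1 → ℝ | p 0 < um} := by
  have h := (semialg_eval hI cRc).isSemialgebraic_sep_lt tarski_seidenberg_real_holds 0 0
  convert h using 1
  ext p
  simp only [mem_setOf_eq, Nat.cast_zero, zero_add, one_mul, Int.cast_zero]
  constructor
  · intro hp
    have hp' : p 0 < -1 := lt_trans hp um_lt
    exact ⟨hp', (Rc_neg_iff hp').mpr hp⟩
  · rintro ⟨hp1, hp2⟩
    exact (Rc_neg_iff hp1).mp hp2

/-- The right piece `{p | u_m < p 0 < −1}` is `ℚ`-semialgebraic. [cite: BochnakCosteRoy1998, §2.2] -/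
theorem isSemialgebraic_right (hI : IsSemialgebraic ℚ {p : Fin 1 → ℝ | p 0 < -1}) :
    IsSemialgebraic ℚ {p : Fin 1 → ℝ | um < p 0 ∧ p 0 < -1} := by
  have h := (semialg_eval hI cRc).fun_neg.isSemialgebraic_sep_lt tarski_seidenberg_real_holds 0 0
  convert h using 1
  ext p
  simp only [mem_setOf_eq, Nat.cast_zero, zero_add, one_mul, Int.cast_zero]
  constructor
  · rintro ⟨hp1, hp2⟩
    exact ⟨hp2, by linarith [(Rc_pos_iff hp2).mpr hp1]⟩
  · rintro ⟨hp1, hp2⟩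
    exact ⟨(Rc_pos_iff hp1).mp (by linarith), hp1⟩

/-- The turning fibre `{p | p 0 = u_m}` is `ℚ`-semialgebraic (difference of the above). [cite: BochnakCosteRoy1998, §2.2] -/
theorem isSemialgebraic_mid (hI : IsSemialgebraic ℚ {p : Fin 1 → ℝ | p 0 < -1}) :
    IsSemialgebraic ℚ {p : Fin 1 → ℝ | p 0 = um} := by
  convert (hI.diff (isSemialgebraic_left hI)).diff (isSemialgebraic_right hI) using 1
  ext p
  simp only [mem_setOf_eq, mem_sdiff, not_and, not_lt]
  constructor
  · intro hp
    refine ⟨⟨by rw [hp]; exact um_lt, by rw [hp]⟩, fun h => absurd h (by rw [hp]; exact lt_irrefl _)⟩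
  · rintro ⟨⟨h1, h2⟩, h3⟩
    have h4 : p 0 ≤ um := by
      by_contra h; rw [not_le] at h; exact absurd h1 (not_lt.mpr (h3 h))
    exact le_antisymm h4 h2

end Semialgebraic

end Summit.KontsevichZagierPeriods.IsogenyCertificates.JLPair
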